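import Summits.NavierStokesRegularity.NavierStokesRegularity.Theorems.ScenarioCensusRowF13dLargeL3Cell

/-!
# Scenario census, sub-row F13dL — part 3/3: Corollary O (the decided cell is OPEN in `L³` with a UNIFORM width),
# Corollaries O′/K′ (dimensionless thresholds), and the CENSUS KEYS `ScenarioCensus.Row_F13dL` / `row_F13dL_excluded` /
# `row_F13dL_of_row_F13mLarge`

Port (typer seat ns-census-typer-1 g6; lead g8 GO 2026-08-28T18:02Z, split «file 2 + keys» agreed with typer-2 g8 18:04Z) of
the ideator's tree-ready kit file 2 `pub/ideators/ns-idea-9/lines/dihedral_noswirl/landing/ScenarioCensusRowF13dLargeL3.lean`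
(ns-idea-9 g6, LINE 14 «dihedral_noswirl» REV 8 bef4d09e9c956928; kit file sha16 c3e138e50225bf3d, 925 l.; ref g7 PRE-CHECK ✓
§12.34 / §12.41, critic idea-crit-8 V56/V57/V58 PASS), on top of typer-2 g8's port of kit file 1
(`Theorems/ScenarioCensusLargeOrderRigidity.lean` and its parts, namespace `…ScenarioCensus.LargeOrderRigidity`).  Split for the
400-line rule into THREE modules: `ScenarioCensusRowF13dLargeL3Cell` (part 1) ← `ScenarioCensusRowF13dLargeL3Minimal` (part 2,
a leaf: the only part importing a module in the cone of route file `Theses/AxisymmetricExtremality.lean`) and part 1 ←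
`ScenarioCensusRowF13dLargeL3` (part 3, the kit's name; it also carries the census keys in namespace `…ScenarioCensus`, which
therefore stay outside that cone).
Declarations VERBATIM in the kit's namespace `…Theorems.ScenarioCensus.RowF13dLargeL3`; the only edits: the kit's
`local notation "ℝ³"` is spelled with the tree abbreviation `LargeOrderRigidity.R3` (typer lint: no notation), and one-line
docstrings are added to two undocumented auxiliaries (`avgSeq_comp`, `measurableSet_parabolicCylinder`), and — to keep parts 1 and 3
(hence the census keys) OUT of the cone of route file `Theses/AxisymmetricExtremality.lean` — the single use of
`PFoldToAxisymmetric.AeAxisymmetricUpgrade.hasGlobalKatoSolution_congr_ae` in `hasGlobalKatoSolution_of_aeDihedral` (part 1) is served by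
the route-independent tree lemma `HasGlobalKatoSolution.congr_datum_ae` (same statement up to `symm`; that module's Literature imports are
imported directly); every statement is unchanged.

This part: **O** `hasGlobalKatoSolution_near_dihedral_of_large_order` — every weakly divergence-free `u₀ ∈ L³` within
`δ(ν,K)·ν` of SOME `D_p`-symmetric budgeted `v₀ ∈ L³`, `p ≥ N(ν,K)`, has a global Kato solution (S1ᴼ `normalisedBadSequenceO`
+ `tendsto_pairing_of_eLpNorm_sub_tendsto_zero`); **O′/K′** `hasGlobalKatoSolution_near_dihedral_of_large_order'` /
`hasGlobalKatoSolution_dihedral_of_large_order'` — `N`, `δ` depend on `K` ALONE (tree `hasGlobalKatoSolution_smul_iff`).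
Then the census keys (namespace `…Theorems.ScenarioCensus`, lead g8 18:02Z [3/3]; the names are the census's, not the kit's):
`Row_F13dL := RowF13dLargeL3.Row_F13dLargeL3` (alias BY NAME, `rfl`), `row_F13dL_excluded : Row_F13dL`
(:= `RowF13dLargeL3.row_F13dLargeL3_holds`, part 1), lattice edge `row_F13dL_of_row_F13mLarge : Row_F13mLarge → Row_F13dL`.
Corollaries D/K/O/O′/K′ are in-row DECIDED members (theorems; no key, no new row — census FROZEN v1.62, cen9 (2)).
The census lead books the value (F13dL OPEN-NO-LINE → EXCLUDED-IN-TREE on ACCEPT + ref CHECK BY NAME).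

**NOT THE ROW:** the census row `Row_F13mLarge` (neither mirror nor budget), `Row_F0`, `Row_F5` are untouched and stay
OPEN; NS regularity is NOT proved; no summit statement is proved in this file.
-/

noncomputable section

set_option linter.dupNamespace false
set_option linter.unusedVariables false

open Set Function Filter Topology MeasureTheory Metric TopologicalSpace
open scoped NNReal ENNReal RealInnerProductSpace

namespace Summit.NavierStokesRegularity.NavierStokesRegularity.Theorems.ScenarioCensus.RowF13dLargeL3

open Literature.Analysis Literature.Analysis.FluidPDE
open Summit.NavierStokesRegularity.NavierStokesRegularity.Theorems.ScenarioCensus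
open Summit.NavierStokesRegularity.NavierStokesRegularity.Theorems.ScenarioCensus.LargeOrderRigidity
open Summit.NavierStokesRegularity.NavierStokesRegularity.Theorems.AxisymmetricKatoGlobal.NoSwirlStratum

/-! ## Corollary O (rev 7) — the decided cell is OPEN in `L³`: a UNIFORM stability width `δ(ν, K)·ν`
around the dihedral large-order budgeted class

The compactness proof gives more than Corollary K for free: the symmetric field need not be the datum
itself.  **For every `ν > 0` and `K` there are `N` and `δ > 0` such that every weakly divergence-free
`u₀ ∈ L³(ℝ³)` within `L³`-distance `δν` of SOME `D_p`-symmetric field `v₀` (`p`-fold about the vertical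
axis, mirror-symmetric in `{x₁ = 0}`, `‖v₀‖₃ ≤ Kν`, `p ≥ N`; `v₀` need not be divergence-free) has a
GLOBAL Kato solution.**  The width `δ` is UNIFORM over the (non-compact, scale- and axial-translation-
invariant) class — not the datum-wise openness of the set of global data.  Mechanism: along a bad sequence
the errors `u₀ʲ − v₀ʲ → 0` in `L³` survive the critical normalisation isometrically, so the weak limit of
the normalised data is also the weak limit of their symmetric companions (`tendsto_pairing_of_eLpNorm_sub_
tendsto_zero`), to which S2ᴰ applies; S3 as before.  NOT THE ROW; no summit statement is proved. -/

section OpenCell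

/-- Weak convergence against test fields passes to an `L³`-asymptotically-equal sequence. -/
theorem tendsto_pairing_of_eLpNorm_sub_tendsto_zero {a s : ℕ → R3 → R3} {L : ℝ}
    (ha : ∀ j, MemLp (a j) 3 volume) (hs : ∀ j, MemLp (s j) 3 volume)
    (hsub : Tendsto (fun j => eLpNorm (a j - s j) 3 volume) atTop (𝓝 0))
    {φ : R3 → R3} (hφ : FunctionSpaces.IsTestFunctionOn (⊤ : Opens R3) φ)
    (hlim : Tendsto (fun j => ∫ x, ⟪a j x, φ x⟫) atTop (𝓝 L)) :
    Tendsto (fun j => ∫ x, ⟪s j x, φ x⟫) atTop (𝓝 L) := by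
  have hφ32 : MemLp φ (3 / 2 : ℝ≥0∞) volume := testFun_memLp hφ _
  -- the error pairings tend to zero (Hölder `L³ × L^{3/2}`)
  have herr : Tendsto (fun j => ∫ x, ⟪(a j - s j) x, φ x⟫) atTop (𝓝 0) := by
    have h0 : Tendsto (fun j => (eLpNorm (a j - s j) 3 volume).toReal) atTop (𝓝 0) := by
      have h := (ENNReal.tendsto_toReal ENNReal.zero_ne_top).comp hsub
      simpa [Function.comp_def] using h
    have hto : Tendsto (fun j => (eLpNorm (a j - s j) 3 volume).toReal *
        (eLpNorm φ (3 / 2 : ℝ≥0∞) volume).toReal) atTop (𝓝 0) := by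
      simpa using h0.mul_const (eLpNorm φ (3 / 2 : ℝ≥0∞) volume).toReal
    refine squeeze_zero_norm (fun j => ?_) hto
    rw [Real.norm_eq_abs]
    exact FunctionSpaces.abs_integral_inner_le_eLpNorm_three_mul_threeHalves ((ha j).sub (hs j)) hφ32
  have heq : ∀ j, ∫ x, ⟪s j x, φ x⟫ = (∫ x, ⟪a j x, φ x⟫) - ∫ x, ⟪(a j - s j) x, φ x⟫ := by
    intro j
    rw [← integral_sub (integrable_inner_test (ha j) hφ) (integrable_inner_test ((ha j).sub (hs j)) hφ)]
    refine integral_congr_ae (ae_of_all _ fun x => ?_)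
    simp only [Pi.sub_apply, inner_sub_left]
    ring
  rw [show (fun j => ∫ x, ⟪s j x, φ x⟫) =
      fun j => (∫ x, ⟪a j x, φ x⟫) - ∫ x, ⟪(a j - s j) x, φ x⟫ from funext heq]
  simpa using hlim.sub herr

/-- **S1ᴼ (normalised bad sequence with symmetric companions; PROVED).**  As S1ᴷ, but the symmetry and
the budget are carried by companion fields `v₀ʲ` with `‖u₀ʲ − v₀ʲ‖₃ ≤ ν/(j+1)`: the normalised data `a j`
(local Leray solutions singular at `(1, 0)`) come with normalised companions `s j` (equivariant, budgeted)
and `‖a j − s j‖₃ → 0`. -/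
theorem normalisedBadSequenceO {ν K : ℝ} (hν : 0 < ν)
    (hbad : ∀ j : ℕ, ∃ m : ℕ, j ≤ m ∧ ∃ u₀ v₀ : R3 → R3, MemLp u₀ 3 volume ∧ IsWeaklyDivFree u₀ ∧
        MemLp v₀ 3 volume ∧
        (∀ x : R3, v₀ (rotZ (2 * Real.pi / m) x) = rotZ (2 * Real.pi / m) (v₀ x)) ∧
        (∀ x : R3, v₀ (reflY x) = reflY (v₀ x)) ∧
        eLpNorm v₀ 3 volume ≤ ENNReal.ofReal (K * ν) ∧
        eLpNorm (u₀ - v₀) 3 volume ≤ ENNReal.ofReal (ν / ((j : ℝ) + 1)) ∧ ¬ HasGlobalKatoSolution ν u₀) :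
    ∃ (m : ℕ → ℕ) (c : ℕ → R3) (a : ℕ → R3 → R3) (w : ℕ → ℝ → R3 → R3) (q : ℕ → ℝ → R3 → ℝ)
      (s : ℕ → R3 → R3),
      Tendsto m atTop atTop ∧ (∀ j, c j 2 = 0) ∧
      (∀ j, MemLp (a j) 3 volume ∧ IsWeaklyDivFree (a j) ∧
        eLpNorm (a j) 3 volume ≤ (((K * ν).toNNReal + ν.toNNReal : ℝ≥0) : ℝ≥0∞)) ∧
      (∀ j, IsLocalLeraySolution ν (a j) (w j) (q j)) ∧
      (∀ j, MemLp (s j) 3 volume ∧ eLpNorm (s j) 3 volume ≤ ((K * ν).toNNReal : ℝ≥0∞)) ∧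
      (∀ j, IsCyclicEquivariantAbout (m j) (c j) (s j)) ∧
      (∀ j, IsMirrorEquivariantAbout (c j) (s j)) ∧
      Tendsto (fun j => eLpNorm (a j - s j) 3 volume) atTop (𝓝 0) ∧
      (∀ j (r : ℝ), 0 < r →
        eLpNorm (uncurry (w j)) ∞ (volume.restrict (parabolicCylinder r ((1 : ℝ), (0 : R3)))) = ∞) := by
  classical
  -- bad data at orders `m_j ≥ j` with companions `v₀ j`
  choose m hm u₀ v₀ h3 hdiv0 h3v hsym hmir hbud hclose hng using hbad
  have hmeasu : ∀ j, AEStronglyMeasurable (u₀ j) volume := fun j => (h3 j).1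
  have hmeasv : ∀ j, AEStronglyMeasurable (v₀ j) volume := fun j => (h3v j).1
  -- the data themselves have budget `(K + 1) ν`
  have hbudu : ∀ j, eLpNorm (u₀ j) 3 volume ≤ (((K * ν).toNNReal + ν.toNNReal : ℝ≥0) : ℝ≥0∞) := by
    intro j
    have hsplit : v₀ j + (u₀ j - v₀ j) = u₀ j := by abel
    calc eLpNorm (u₀ j) 3 volume = eLpNorm (v₀ j + (u₀ j - v₀ j)) 3 volume := by rw [hsplit]
      _ ≤ eLpNorm (v₀ j) 3 volume + eLpNorm (u₀ j - v₀ j) 3 volume :=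
          eLpNorm_add_le (hmeasv j) ((hmeasu j).sub (hmeasv j)) (by norm_num)
      _ ≤ ENNReal.ofReal (K * ν) + ENNReal.ofReal (ν / ((j : ℝ) + 1)) := add_le_add (hbud j) (hclose j)
      _ ≤ ENNReal.ofReal (K * ν) + ENNReal.ofReal ν := by
          gcongr
          exact div_le_self hν.le (by linarith [j.cast_nonneg (α := ℝ)])
      _ = (((K * ν).toNNReal + ν.toNNReal : ℝ≥0) : ℝ≥0∞) := by rw [ENNReal.coe_add]; rfl
  -- maximal Kato solutions with a singular point `(T_j, x_j)`, `T_j = T_max(u₀ j)`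
  have hmax : ∀ j, ∃ T : ℝ, 0 < T ∧ ∃ (x₀ : R3) (u : ℝ → R3 → R3), IsKatoSolutionOn T ν (u₀ j) u ∧
      ∀ r : ℝ, 0 < r → eLpNorm (uncurry u) ∞ (volume.restrict (parabolicCylinder r ((T : ℝ), x₀))) = ∞ := by
    intro j
    obtain ⟨hpos, htop, xs, u, hu, hsing⟩ := exists_singularPoint_katoMaximalTime kato_local_holds
      IsKatoSolutionOn.continuation_of_bounded_holds IsKatoSolutionOn.farField_bound_holds hν (h3 j)
      (hdiv0 j) (hng j)
    exact ⟨_, ENNReal.toReal_pos hpos.ne' htop.ne, xs, u, hu, hsing⟩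
  choose T hT x u hK hx using hmax
  -- scales `λ_j = √T_j`
  set lam : ℕ → ℝ := fun j => Real.sqrt (T j) with hlam_def
  have hlam : ∀ j, 0 < lam j := fun j => Real.sqrt_pos.2 (hT j)
  have hlam2 : ∀ j, lam j ^ 2 = T j := fun j => Real.sq_sqrt (hT j).le
  -- normalised data, Kato solutions on `[0, 1)`, and normalised companions
  set a : ℕ → R3 → R3 := fun j => rescaleData (lam j) fun y => u₀ j (y - -x j) with ha_def
  set v : ℕ → ℝ → R3 → R3 := fun j t y => lam j • u j (lam j ^ 2 * t) (lam j • y - -x j) with hv_def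
  set s : ℕ → R3 → R3 := fun j => rescaleData (lam j) fun y => v₀ j (y - -x j) with hs_def
  have hK1 : ∀ j, IsKatoSolutionOn 1 ν (a j) (v j) := by
    intro j
    obtain ⟨h1, h2, h3', h4⟩ := kato_local_rescale_translate (hK j).mild (hK j).continuousInLpOn
      (hK j).initial (hK j).aestronglyMeasurable (hlam j) (-x j)
    have h1T : T j / lam j ^ 2 = 1 := by rw [hlam2, div_self (hT j).ne']
    rw [h1T] at h1 h2 h4
    exact ⟨h1, h2, h3', h4⟩
  have ha3 : ∀ j, MemLp (a j) 3 volume := fun j => by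
    have h := (hK1 j).memLp (t := 0) ⟨le_rfl, one_pos⟩
    rwa [(hK1 j).initial] at h
  have hdiv : ∀ j, IsWeaklyDivFree (a j) := fun j => by
    have h := (hK1 j).mild.1 0 ⟨le_rfl, one_pos⟩
    rwa [(hK1 j).initial] at h
  have hnorm : ∀ j, eLpNorm (a j) 3 volume ≤ (((K * ν).toNNReal + ν.toNNReal : ℝ≥0) : ℝ≥0∞) := fun j => by
    have e1 : eLpNorm (a j) 3 volume = eLpNorm (fun y => u₀ j (y - -x j)) 3 volume :=
      eLpNorm_three_rescaleData _ (hlam j)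
    have e2 : eLpNorm (fun y => u₀ j (y - -x j)) 3 volume = eLpNorm (u₀ j) 3 volume :=
      eLpNorm_comp_measurePreserving (g := u₀ j) (f := fun y : R3 => y - -x j) (hmeasu j)
        (measurePreserving_sub_right volume (-x j))
    rw [e1, e2]
    exact hbudu j
  -- the companions: `L³`, budget `K ν`, and `‖a j − s j‖₃ = ‖u₀ j − v₀ j‖₃ → 0`
  have hs3 : ∀ j, MemLp (s j) 3 volume := fun j =>
    memLp_three_rescaleData
      ((h3v j).comp_measurePreserving (measurePreserving_sub_right volume (-x j))) (hlam j)
  have hsnorm : ∀ j, eLpNorm (s j) 3 volume ≤ ((K * ν).toNNReal : ℝ≥0∞) := fun j => by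
    have e1 : eLpNorm (s j) 3 volume = eLpNorm (fun y => v₀ j (y - -x j)) 3 volume :=
      eLpNorm_three_rescaleData _ (hlam j)
    have e2 : eLpNorm (fun y => v₀ j (y - -x j)) 3 volume = eLpNorm (v₀ j) 3 volume :=
      eLpNorm_comp_measurePreserving (g := v₀ j) (f := fun y : R3 => y - -x j) (hmeasv j)
        (measurePreserving_sub_right volume (-x j))
    rw [e1, e2]
    exact hbud j
  have hdiff : ∀ j, a j - s j = rescaleData (lam j) (fun y => (u₀ j - v₀ j) (y - -x j)) := by
    intro j
    funext y
    simp [ha_def, hs_def, rescaleData, smul_sub]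
  have hsubj : Tendsto (fun j => eLpNorm (a j - s j) 3 volume) atTop (𝓝 0) := by
    have hb : ∀ j, eLpNorm (a j - s j) 3 volume ≤ ENNReal.ofReal (ν / ((j : ℝ) + 1)) := by
      intro j
      have e1 : eLpNorm (a j - s j) 3 volume = eLpNorm (fun y => (u₀ j - v₀ j) (y - -x j)) 3 volume := by
        rw [hdiff j, eLpNorm_three_rescaleData _ (hlam j)]
      have e2 : eLpNorm (fun y => (u₀ j - v₀ j) (y - -x j)) 3 volume = eLpNorm (u₀ j - v₀ j) 3 volume :=
        eLpNorm_comp_measurePreserving (g := u₀ j - v₀ j) (f := fun y : R3 => y - -x j)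
          ((hmeasu j).sub (hmeasv j)) (measurePreserving_sub_right volume (-x j))
      rw [e1, e2]
      exact hclose j
    have h0 : Tendsto (fun j : ℕ => ENNReal.ofReal (ν / ((j : ℝ) + 1))) atTop (𝓝 0) := by
      rw [← ENNReal.ofReal_zero]
      refine ENNReal.tendsto_ofReal ?_
      have h := (tendsto_one_div_add_atTop_nhds_zero_nat).const_mul ν
      rw [mul_zero] at h
      refine h.congr fun j => ?_
      ring
    exact tendsto_of_tendsto_of_tendsto_of_le_of_le tendsto_const_nhds h0 (fun _ => zero_le) hb
  -- local Leray solutions a.e. equal to the normalised Kato solutions on `(0, 1) × ℝ³`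
  have hLer : ∀ j, ∃ (w : ℝ → R3 → R3) (q : ℝ → R3 → ℝ), IsLocalLeraySolution ν (a j) w q ∧
      uncurry w =ᵐ[volume.restrict (Ioo 0 1 ×ˢ (univ : Set R3))] uncurry (v j) := fun j =>
    leray_solution_exists_ae_eq_kato_holds hν one_pos (ha3 j) (hdiv j) (hK1 j)
  choose w q hw hae using hLer
  -- the normalised Kato solutions are singular at `(1, 0)`
  have hvsing : ∀ j (r : ℝ), 0 < r →
      eLpNorm (uncurry (v j)) ∞ (volume.restrict (parabolicCylinder r ((1 : ℝ), (0 : R3)))) = ∞ := by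
    intro j r hr
    have h := eLpNorm_top_uncurry_rescale_translate (u j) (hlam j) (-x j) r 1 0
    have e1 : (lam j ^ 2 * 1 : ℝ) = T j := by rw [mul_one, hlam2]
    have e2 : lam j • (0 : R3) - -x j = x j := by rw [smul_zero, sub_neg_eq_add, zero_add]
    rw [e1, e2, hx j (lam j * r) (mul_pos (hlam j) hr),
      ENNReal.mul_top (enorm_ne_zero.2 (hlam j).ne')] at h
    exact h
  -- hence so are the local Leray solutions
  have hwsing : ∀ j (r : ℝ), 0 < r →
      eLpNorm (uncurry (w j)) ∞ (volume.restrict (parabolicCylinder r ((1 : ℝ), (0 : R3)))) = ∞ := by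
    intro j r hr
    refine eLpNorm_top_parabolicCylinder_eq_top_of_small one_pos (fun ρ hρ hρ1 => ?_) hr
    rw [eLpNorm_congr_ae (ae_restrict_of_ae_restrict_of_subset
      (parabolicCylinder_one_subset_strip hρ1) (hae j))]
    exact hvsing j ρ hρ
  -- the package
  refine ⟨m, fun j => axisCentre (lam j) (x j), a, w, q, s, ?_, fun j => rfl, fun j =>
    ⟨ha3 j, hdiv j, hnorm j⟩, hw, fun j => ⟨hs3 j, hsnorm j⟩, fun j => ?_, fun j => ?_, hsubj, hwsing⟩
  · exact tendsto_atTop_atTop.2 fun b => ⟨b, fun j hj => le_trans hj (hm j)⟩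
  · -- equivariance of the companion about the moved axis
    intro y
    show lam j • v₀ j (lam j • (axisCentre (lam j) (x j) +
        rotZ (2 * Real.pi / m j) (y - axisCentre (lam j) (x j))) - -x j) =
      rotZ (2 * Real.pi / m j) (lam j • v₀ j (lam j • y - -x j))
    rw [normalise_conj_rotZ (hlam j).ne', hsym j, rotZ_smul']
  · -- mirror-equivariance of the companion about the moved plane
    intro y
    show lam j • v₀ j (lam j • (axisCentre (lam j) (x j) +
        reflY (y - axisCentre (lam j) (x j))) - -x j) =
      reflY (lam j • v₀ j (lam j • y - -x j))
    rw [normalise_conj_reflY (hlam j).ne', hmir j, map_smul]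

/-- **COROLLARY O (rev 7, PROVED): the dihedral large-order cell is OPEN in `L³`, with a width UNIFORM over
the class.**  For every `ν > 0` and `K` there are `N` and `δ > 0` such that every weakly divergence-free
`u₀ ∈ L³(ℝ³)` with `‖u₀ − v₀‖_{L³} ≤ δν` for some `p`-fold (`p ≥ N`) and mirror-symmetric `v₀ ∈ L³` with
`‖v₀‖_{L³} ≤ Kν` has a global Kato solution.  (`v₀ := u₀` recovers Corollary K.)  NOT THE ROW; no summit
statement is proved. -/
theorem hasGlobalKatoSolution_near_dihedral_of_large_order (ν K : ℝ) (hν : 0 < ν) :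
    ∃ N : ℕ, ∃ δ : ℝ, 0 < δ ∧ ∀ p : ℕ, N ≤ p → ∀ u₀ v₀ : R3 → R3, MemLp u₀ 3 volume →
      IsWeaklyDivFree u₀ → MemLp v₀ 3 volume →
      (∀ x : R3, v₀ (rotZ (2 * Real.pi / p) x) = rotZ (2 * Real.pi / p) (v₀ x)) →
      (∀ x : R3, v₀ (reflY x) = reflY (v₀ x)) →
      eLpNorm v₀ 3 volume ≤ ENNReal.ofReal (K * ν) →
      eLpNorm (u₀ - v₀) 3 volume ≤ ENNReal.ofReal (δ * ν) → HasGlobalKatoSolution ν u₀ := by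
  by_contra h
  push Not at h
  -- a bad sequence with widths `δ_j = 1/(j+1)`
  have hbad : ∀ j : ℕ, ∃ m : ℕ, j ≤ m ∧ ∃ u₀ v₀ : R3 → R3, MemLp u₀ 3 volume ∧ IsWeaklyDivFree u₀ ∧
      MemLp v₀ 3 volume ∧
      (∀ x : R3, v₀ (rotZ (2 * Real.pi / m) x) = rotZ (2 * Real.pi / m) (v₀ x)) ∧
      (∀ x : R3, v₀ (reflY x) = reflY (v₀ x)) ∧
      eLpNorm v₀ 3 volume ≤ ENNReal.ofReal (K * ν) ∧
      eLpNorm (u₀ - v₀) 3 volume ≤ ENNReal.ofReal (ν / ((j : ℝ) + 1)) ∧ ¬ HasGlobalKatoSolution ν u₀ := by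
    intro j
    obtain ⟨p, hp, u₀, v₀, h1, h2, h3, h4, h5, h6, h7, h8⟩ := h j (1 / ((j : ℝ) + 1)) (by positivity)
    refine ⟨p, hp, u₀, v₀, h1, h2, h3, h4, h5, h6, ?_, h8⟩
    rwa [one_div_mul_eq_div] at h7
  -- S1ᴼ
  obtain ⟨m, c, a, w, q, s, hm, hc, ha, hw, hs, hsym, hmir, hsub, hsing⟩ :=
    normalisedBadSequenceO (K := K) hν hbad
  -- weak `L³` stability of local Leray solutions with stability of singular points (tree theorem)
  obtain ⟨σ, a', U, P, hσ, ha'3, ha'div, ha'le, hweak, hU, hstab, -⟩ :=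
    leray_solution_L3_weak_stability_holds hν ((K * ν).toNNReal + ν.toNNReal) a w q ha hw
  have hUsing : ∀ r : ℝ, 0 < r →
      eLpNorm (uncurry U) ∞ (volume.restrict (parabolicCylinder r ((1 : ℝ), (0 : R3)))) = ∞ :=
    hstab 1 0 one_pos (fun k r hr => hsing (σ k) r hr)
  -- the weak limit of the data is the weak limit of their symmetric companions
  have hweak' : ∀ φ : R3 → R3, FunctionSpaces.IsTestFunctionOn (⊤ : Opens R3) φ →
      Tendsto (fun j => ∫ x, ⟪s (σ j) x, φ x⟫) atTop (𝓝 (∫ x, ⟪a' x, φ x⟫)) := fun φ hφ =>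
    tendsto_pairing_of_eLpNorm_sub_tendsto_zero (a := a ∘ σ) (s := s ∘ σ) (fun j => (ha (σ j)).1)
      (fun j => (hs (σ j)).1) (hsub.comp hσ.tendsto_atTop) hφ (hweak φ hφ)
  -- S2ᴰ on the companions: the limit is a.e.-axisymmetric and a.e.-mirror-symmetric
  obtain ⟨ξ, hξ, hax, hmx⟩ := profileRigidityD (M := (K * ν).toNNReal) (m := m ∘ σ) (c := c ∘ σ)
    (a := s ∘ σ) (f := a') (hm.comp hσ.tendsto_atTop) (fun j => hc (σ j))
    (fun j => hs (σ j)) (fun j => hsym (σ j)) (fun j => hmir (σ j)) ha'3 hweak'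
  -- S3: no singular point — contradiction
  obtain ⟨r, hr, hfin⟩ := noSwirlL3LerayRegular_holds ν hν ξ a' U P hξ ha'3 ha'div hax hmx hU 1 0 one_pos
  exact hfin.ne (hUsing r hr)

end OpenCell

/-! ## Corollaries O′ / K′ (rev 8) — DIMENSIONLESS thresholds: `N` and `δ` depend on the budget `K` alone

By the viscosity scaling `u₀ ↦ ν⁻¹ • u₀` of Kato solutions (tree `hasGlobalKatoSolution_smul_iff`, Rusin–Šverák
normalisation) the thresholds of Corollaries O and K can be taken UNIFORM in `ν > 0`.  NOT THE ROW; no summit. -/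

section Dimensionless

/-- **COROLLARY O′ (PROVED): Corollary O with `N(K)`, `δ(K)` uniform in the viscosity.** -/
theorem hasGlobalKatoSolution_near_dihedral_of_large_order' (K : ℝ) :
    ∃ N : ℕ, ∃ δ : ℝ, 0 < δ ∧ ∀ ν : ℝ, 0 < ν → ∀ p : ℕ, N ≤ p → ∀ u₀ v₀ : R3 → R3,
      MemLp u₀ 3 volume → IsWeaklyDivFree u₀ → MemLp v₀ 3 volume →
      (∀ x : R3, v₀ (rotZ (2 * Real.pi / p) x) = rotZ (2 * Real.pi / p) (v₀ x)) →
      (∀ x : R3, v₀ (reflY x) = reflY (v₀ x)) →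
      eLpNorm v₀ 3 volume ≤ ENNReal.ofReal (K * ν) →
      eLpNorm (u₀ - v₀) 3 volume ≤ ENNReal.ofReal (δ * ν) → HasGlobalKatoSolution ν u₀ := by
  obtain ⟨N, δ, hδ, h1⟩ := hasGlobalKatoSolution_near_dihedral_of_large_order 1 K one_pos
  refine ⟨N, δ, hδ, fun ν hν p hp u₀ v₀ hu3 hdiv hv3 hsym hmir hbud hclose => ?_⟩
  have hν' : 0 < ν⁻¹ := inv_pos.2 hν
  have hν0 : ν ≠ 0 := hν.ne'
  -- the `L³` norm under the amplitude scaling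
  have hsc : ∀ f : R3 → R3, eLpNorm (ν⁻¹ • f) 3 volume = ENNReal.ofReal ν⁻¹ * eLpNorm f 3 volume := by
    intro f
    rw [eLpNorm_const_smul, Real.enorm_eq_ofReal hν'.le]
  -- the unit-viscosity statement applied to `ν⁻¹ • u₀`, `ν⁻¹ • v₀`
  have hglob : HasGlobalKatoSolution 1 (ν⁻¹ • u₀) := by
    refine h1 p hp (ν⁻¹ • u₀) (ν⁻¹ • v₀) (hu3.const_smul ν⁻¹) (hdiv.const_smul ν⁻¹)
      (hv3.const_smul ν⁻¹) (fun x => ?_) (fun x => ?_) ?_ ?_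
    · simp only [Pi.smul_apply]
      rw [hsym x, rotZ_smul']
    · simp only [Pi.smul_apply]
      rw [hmir x, map_smul]
    · rw [hsc]
      calc ENNReal.ofReal ν⁻¹ * eLpNorm v₀ 3 volume
          ≤ ENNReal.ofReal ν⁻¹ * ENNReal.ofReal (K * ν) := by gcongr
        _ = ENNReal.ofReal (K * 1) := by
          rw [← ENNReal.ofReal_mul hν'.le]
          congr 1
          field_simp
    · rw [← smul_sub, hsc]
      calc ENNReal.ofReal ν⁻¹ * eLpNorm (u₀ - v₀) 3 volume
          ≤ ENNReal.ofReal ν⁻¹ * ENNReal.ofReal (δ * ν) := by gcongr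
        _ = ENNReal.ofReal (δ * 1) := by
          rw [← ENNReal.ofReal_mul hν'.le]
          congr 1
          field_simp
  -- back to viscosity `ν`
  have h2 := (hasGlobalKatoSolution_smul_iff (u₀ := u₀) (ν := ν) hν').1
  rw [inv_mul_cancel₀ hν0] at h2
  exact h2 hglob

/-- **COROLLARY K′ (PROVED): Corollary K with a threshold `N(K)` uniform in the viscosity** (`v₀ := u₀`). -/
theorem hasGlobalKatoSolution_dihedral_of_large_order' (K : ℝ) :
    ∃ N : ℕ, ∀ ν : ℝ, 0 < ν → ∀ p : ℕ, N ≤ p → ∀ u₀ : R3 → R3, MemLp u₀ 3 volume →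
      IsWeaklyDivFree u₀ →
      (∀ x : R3, u₀ (rotZ (2 * Real.pi / p) x) = rotZ (2 * Real.pi / p) (u₀ x)) →
      (∀ x : R3, u₀ (reflY x) = reflY (u₀ x)) →
      eLpNorm u₀ 3 volume ≤ ENNReal.ofReal (K * ν) → HasGlobalKatoSolution ν u₀ := by
  obtain ⟨N, δ, hδ, h⟩ := hasGlobalKatoSolution_near_dihedral_of_large_order' K
  refine ⟨N, fun ν hν p hp u₀ hu3 hdiv hsym hmir hbud =>
    h ν hν p hp u₀ u₀ hu3 hdiv hu3 hsym hmir hbud ?_⟩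
  rw [sub_self, eLpNorm_zero]
  exact zero_le

end Dimensionless

end Summit.NavierStokesRegularity.NavierStokesRegularity.Theorems.ScenarioCensus.RowF13dLargeL3

/-! ## Census keys (sub-row F13dL of row F13mL) -/

namespace Summit.NavierStokesRegularity.NavierStokesRegularity.Theorems.ScenarioCensus

/-- Census sub-row F13dL (⊂ F13mL) — (I ∨ II / forward, Clay frame of rows F0 / F13m VERBATIM · DIHEDRAL symmetry of the datum:
`m`-fold about the `x₃`-axis (`rotZ (2π/m)`) AND mirror-symmetric in `{x₁ = 0}` (`reflY`) · inside an `L³` BUDGET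
`‖u 0‖₃ ≤ K ν` · LARGE order: `∀ ν > 0, ∀ K, ∃ m₀(ν, K), ∀ m ≥ m₀`): the Leray–Hopf classical solution extends past every
`T`, BY NAME `RowF13dLargeL3.Row_F13dLargeL3` (ns-idea-9 LINE 14 «dihedral_noswirl» REV 8, VERBATIM).  Closed by
`row_F13dL_excluded`; the census lead books the value. -/
def Row_F13dL : Prop := RowF13dLargeL3.Row_F13dLargeL3

/-- F13dL is PROVED in the tree: `RowF13dLargeL3.row_F13dLargeL3_holds` (S1ᴰ normalised bad sequence → weak-`L³` stability
of local Leray solutions with stable singular points → S2ᴰ profile rigidity at diverging order: the limit datum is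
a.e.-axisymmetric AND a.e.-mirror-symmetric = swirl-free → S3 swirl-free axisymmetric `L³` regularity from the tree's global
Kato theorem).  NOT the row F13mL (no mirror, no budget), which stays OPEN; no summit proved. -/
theorem row_F13dL_excluded : Row_F13dL := RowF13dLargeL3.row_F13dLargeL3_holds

/-- Lattice edge F13mLarge ⇒ F13dL (the large-order row `Row_F13mLarge` implies its dihedral budgeted sub-cell: the mirror and
budget hypotheses are dropped), BY NAME `RowF13dLargeL3.row_F13dLargeL3_of_row_F13mLarge`. -/
theorem row_F13dL_of_row_F13mLarge (h : Row_F13mLarge) : Row_F13dL :=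
  RowF13dLargeL3.row_F13dLargeL3_of_row_F13mLarge h

end Summit.NavierStokesRegularity.NavierStokesRegularity.Theorems.ScenarioCensus

end
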